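import Summits.ABC.ABC.Theses.DefiniteXi
import Literature.NumberTheory.EllipticCurves.OpenImageMazurAssemblyProofs
import Literature.NumberTheory.EllipticCurves.OpenImageMazurInertiaThreeProofs
import Literature.NumberTheory.EllipticCurves.OpenImageMazurTwistProofs
import Literature.NumberTheory.EllipticCurves.CyclicIsogenyCharacterFrobeniusProofs
import Literature.NumberTheory.EllipticCurves.RationalIsogenyFrobeniusCriterionPrimePower
import Literature.NumberTheory.EllipticCurves.RationalIsogenyDegreesProofs
import Literature.NumberTheory.EllipticCurves.OrdinaryReductionTorsionCharactersProofs
import Literature.NumberTheory.EllipticCurves.OrdinaryReductionUnramifiedCharacterProofs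
import Literature.NumberTheory.EllipticCurves.TateCurve.NumberFieldUniformizationTwisted
import Literature.NumberTheory.EllipticCurves.QuadraticTwistTateFormProofs
import Literature.NumberTheory.EllipticCurves.KernelReductionInertiaProofs
import Literature.NumberTheory.EllipticCurves.SemistableModPImageMultiplicativeProofs
import Literature.NumberTheory.EllipticCurves.SupersingularModPDecompositionImageProofs
import Literature.NumberTheory.EllipticCurves.BSDSelmerPConverseSerreProofs
import HarnessLib

/-!
# Stub-ideation k=2 (gen 4, FAMILY 2 — RESHAPE) for `stub_pasten163` — crux `DefiniteRTControlPrime`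

Companion to `STUB-IDEAS-stub_pasten163-2.md` (gen 4; supersedes gen 3's
`Lines/StubIdeasK2g3_pasten163.lean`, whose typed OUTPUT — `frobNorm`, H5, C0
`CyclicDegreeDvdFrobNormSq`, `FreyIsogenyDiameter`, `freyIsogenyDiameter_of_halfLevel` — is kept
VERBATIM so k1's `definiteRTControlPrime_of_diameter` and gen-3's counting end apply unchanged).
Every `sorry` is a HELPER for the stub prover; `U1`, `T1`, `C1` are proved (carried from gen 3).

Plan A (verbatim stub) = import `IsogenyGlueCongruence.MazurKenkuBound` (stmt-ABC-15125) by name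
(`Iff.rfl`); `163` is attained (`PastenShimura2024_minimalDegree_le_163_mul_iff`), so nothing
Mazur-free proves the verbatim constant.  Plan B (RESHAPE, all ideators since gen 2): replace `163`
by a Mazur–Kenku-free bound on the cyclic-isogeny DIAMETER of the Frey class, fed to k1's
`definiteRTControlPrime_of_diameter` through the crux's idle `C·N^ε`.

GEN-4 CUT ("character-free two-sided Serre sandwich at half level").  Gen 3 (this seat) pinned
`r|I_ℓ ∈ {1, χ}` EXACTLY through a filtration dichotomy (D1/D2/D3/D5 + CycRes — D3, the global↔local
transport of the twisted Tate uniformisation at `v = ℓ`, was the hardest helper of every gen-3/gen-4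
plan, cf. k3 g4).  Here the place `ℓ` is handled WITHOUT any character identification:

* (X) per `τ ∈ I_ℓ`: `#((τ−1)·W[ℓᵏ]) ≤ ℓᵏ` — LANDED for good ordinary reduction
  (`WeierstrassCurve.card_map_smul_sub_geomTorsion_le_pow`, Serre 1968 IV A.2.2), a `1 ↦ k` port of
  the landed `exists_addSubgroup_card_le_of_hasMultiplicativeReductionAt` for multiplicative
  reduction; supersingular is excluded by the stable line (SS);
* (DET) the quotient character of the line is `χ_{ℓᵏ}·r⁻¹` (`det ρ = χ`, landed
  `det_eq_modNCyclotomicCharacter` at level `m`; prime-level pattern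
  `Mazur1978.smul_sub_smul_mem_zmultiples_of_isogenyCharacter`);
* (ALG1) pure algebra: a rank-`≤ ℓᵏ` image of `τ − 1` on `(ℤ/ℓᵏ)²` with a stable primitive line
  forces `v_ℓ(r(τ)−1) + v_ℓ((χr⁻¹)(τ)−1) ≥ k`; (ALG2) the per-`τ` sandwich is uniform on `I_ℓ`:
  `∃ a + b = k`, `r ≡ 1 (ℓᵃ)`, `χr⁻¹ ≡ 1 (ℓᵇ)` on `I_ℓ` — and `max(a,b) ≥ ⌈k/2⌉`;
* away from `ℓ` both characters are `≡ 1 mod ℓ^⌈k/2⌉` on inertia after a 12th power (good: landed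
  `cyclicCharacter_eq_one_of_mem_inertia`; multiplicative: landed `(τ−1)²P = 0` + U1 (U2); the place
  `2`: T1 (`v₂(j) ≥ 0`, PROVED) / T2 (`v₂(j) < 0`); `χ` is unramified away from `ℓ`);
* Minkowski (`Mazur1978.monoidHom_eq_one_of_forall_inertia`) on the truncations of `r¹²` and of
  `(χr⁻¹)¹²` (MK), Frobenius (`cyclicCharacter_sq_sub_frobeniusTrace_mul_add_eq_zero`, `χ(Frob_p) = p`)
  and A1 (both branches `λ¹² ≡ 1`, `λ¹² ≡ p¹²`) give `ℓ^⌈k/2⌉ ∣ n₁₂(p)` = gen-3 H5, hence C0.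
No basis, no ε, no normal form, no filtration characters, no second curve.
-/

namespace Summit.ABC.ABC.Cruxes.DefiniteRTControlPrime.Sketch.Ideas2g4

open Literature.NumberTheory.EllipticCurves Literature.NumberTheory.GaloisRepresentations
open WeierstrassCurve IsDedekindDomain NumberField Field

/-- `⌈k/2⌉`, the halved exponent. -/
def halfCeil (k : ℕ) : ℕ := (k + 1) / 2

theorem halfCeil_le (k : ℕ) : halfCeil k ≤ k := by unfold halfCeil; omega

theorem le_two_mul_halfCeil (k : ℕ) : k ≤ 2 * halfCeil k := by unfold halfCeil; omega

theorem pow_halfCeil_dvd (ℓ k : ℕ) : ℓ ^ halfCeil k ∣ ℓ ^ k := pow_dvd_pow ℓ (halfCeil_le k)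

/-- `halfCeil_le_max`: the pigeonhole behind the half level — `a + b ≥ k ⇒ max a b ≥ ⌈k/2⌉`. -/
theorem halfCeil_le_max {k a b : ℕ} (h : k ≤ a + b) : halfCeil k ≤ max a b := by
  unfold halfCeil; omega

/-- DEPTH: `u ≡ 1 mod ℓᵃ` for a unit `u` of `ℤ/ℓᵏ` (for `a ≥ k` this says `u = 1`). All local and
global statements of the line are phrased with it (no `ZMod.unitsMap` bookkeeping in signatures). -/
def Depth (ℓ k a : ℕ) (u : (ZMod (ℓ ^ k))ˣ) : Prop :=
  (ℓ : ℤ) ^ a ∣ (((u : ZMod (ℓ ^ k)).val : ℕ) : ℤ) - 1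

/-! ## U — unipotence on the line at a multiplicative `v ∤ ℓ`, at half level (gen 3, kept) -/

/-- U1 (pure arithmetic, PROVED): `(s−1)²·P = 0` for `P` of order `ℓᵏ` forces `ℓ^⌈k/2⌉ ∣ s − 1`. -/
theorem pow_halfCeil_dvd_of_sq_smul_eq_zero {M : Type*} [AddCommGroup M] {ℓ k : ℕ} (hℓ : ℓ.Prime)
    {P : M} (hP : addOrderOf P = ℓ ^ k) {s : ℤ} (hs : ((s - 1) ^ 2) • P = 0) :
    (ℓ : ℤ) ^ halfCeil k ∣ s - 1 := by
  haveI := Fact.mk hℓ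
  have h1 : ((ℓ : ℤ) ^ k) ∣ (s - 1) ^ 2 := by
    have := addOrderOf_dvd_iff_zsmul_eq_zero.mpr hs
    rw [hP] at this
    exact_mod_cast this
  rcases eq_or_ne (s - 1) 0 with h0 | h0
  · rw [h0]; exact dvd_zero _
  rw [padicValInt_dvd_iff] at h1 ⊢
  refine Or.inr ?_
  rcases h1 with h1 | h1
  · exact absurd (pow_eq_zero_iff two_ne_zero |>.mp h1) h0
  · rw [pow_two, padicValInt.mul h0 h0] at h1
    unfold halfCeil
    omega

/-- U2 (S, one cycle): at a multiplicative place `v ∤ ℓ` the character `r` of a stable cyclic line of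
order `ℓᵏ` has depth `⌈k/2⌉` on inertia.  Proof: the tree's
`WeierstrassCurve.smul_smul_sub_eq_of_mem_inertia_geomPoints` gives `τ(τP − P) = τP − P`, i.e.
`((r τ).val − 1)²·P = 0`; then U1. -/
theorem depth_halfCeil_of_hasMultiplicativeReductionAt (W : WeierstrassCurve ℚ)
    [W.IsElliptic] {v : HeightOneSpectrum (𝓞 ℚ)} (hv : W.HasMultiplicativeReductionAt v)
    {ℓ k : ℕ} [Fact ℓ.Prime] (hℓv : (ℓ : 𝓞 ℚ) ∉ v.asIdeal) (hk : 1 ≤ k)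
    {P : geomPoints W} (hP : addOrderOf P = ℓ ^ k)
    {r : absoluteGaloisGroup ℚ →* (ZMod (ℓ ^ k))ˣ}
    (hr : ∀ σ : absoluteGaloisGroup ℚ, σ • P = ((r σ : (ZMod (ℓ ^ k))ˣ) : ZMod (ℓ ^ k)).val • P)
    {𝔓 : Ideal (absIntegers (𝓞 ℚ) ℚ)} (h𝔓 : 𝔓 ∈ v.primesAbove)
    {τ : absoluteGaloisGroup ℚ} (hτ : τ ∈ 𝔓.inertia (absoluteGaloisGroup ℚ)) :
    Depth ℓ k (halfCeil k) (r τ) := by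
  sorry

/-! ## T — the place `2` (`ℓᵏ` odd), on the line (gen 3, kept) -/

/-- T1 (PROVED modulo the tree): `j` integral at a place `v ∤ 3m` ⇒ `r(τ)¹² = 1` on inertia at `v`
(`Mazur1978.pow_twelve_smul_eq_of_mem_inertia_of_valuation_j_le_one_of_three` +
`Mazur1978.eq_one_of_val_smul_eq_of_addOrderOf`).  Used at `v = 2`, `m = ℓᵏ`. -/
theorem cyclicCharacter_pow_twelve_eq_one_of_valuation_j_le_one (W : WeierstrassCurve ℚ)
    [W.IsElliptic] {m : ℕ} [NeZero m] {P : geomPoints W} (hP : addOrderOf P = m)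
    {r : absoluteGaloisGroup ℚ →* (ZMod m)ˣ}
    (hr : ∀ σ : absoluteGaloisGroup ℚ, σ • P = ((r σ : (ZMod m)ˣ) : ZMod m).val • P)
    {v : HeightOneSpectrum (𝓞 ℚ)} (h3 : (3 : 𝓞 ℚ) ∉ v.asIdeal) (hmv : (m : 𝓞 ℚ) ∉ v.asIdeal)
    (hj : v.valuation ℚ W.j ≤ 1)
    {𝔓 : Ideal (absIntegers (𝓞 ℚ) ℚ)} (h𝔓 : 𝔓 ∈ v.primesAbove)
    {τ : absoluteGaloisGroup ℚ} (hτ : τ ∈ 𝔓.inertia (absoluteGaloisGroup ℚ)) :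
    r τ ^ 12 = 1 := by
  have hmP : m • P = 0 := by rw [← hP]; exact addOrderOf_nsmul_eq_zero P
  have h12 : τ ^ 12 • P = P :=
    Mazur1978.pow_twelve_smul_eq_of_mem_inertia_of_valuation_j_le_one_of_three W h3 hj h𝔓 hτ hmv hmP
  have h' : ((r (τ ^ 12) : (ZMod m)ˣ) : ZMod m).val • P = P := by rw [← hr]; exact h12
  have h1 : ((r (τ ^ 12) : (ZMod m)ˣ) : ZMod m) = 1 :=
    Mazur1978.eq_one_of_val_smul_eq_of_addOrderOf W hP h'
  rw [map_pow] at h1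
  exact Units.val_eq_one.mp h1

/-- T2 (M, one cycle): `v(j) < 0` at a place `v ∤ ℓ` (here `v = 2`) ⇒ `r(τ)²` has depth `⌈k/2⌉` on
inertia at `v`.  Proof: a quadratic twist `W^{(d)}` is multiplicative at `v`
(`exists_hasMultiplicativeReductionAt_quadraticTwist_of_one_lt_valuation_j`); the signed equivariant
`W^{(d)}(ℚ̄) ≃+ W(ℚ̄)` (`exists_addEquiv_geomPoints_quadraticTwist_signed`) carries `P` to a point of
order `ℓᵏ` on which `τ` acts by `±(r τ).val`; U2's argument on `W^{(d)}` gives `±r(τ) ≡ 1`, so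
`r(τ)² ≡ 1 (ℓ^⌈k/2⌉)`.  (Prime-level pattern: `Mazur1978.isogenyCharacter_sq_eq_one_of_one_lt_valuation_j`.) -/
theorem depth_halfCeil_sq_of_one_lt_valuation_j (W : WeierstrassCurve ℚ)
    [W.IsElliptic] {v : HeightOneSpectrum (𝓞 ℚ)} (hj : 1 < v.valuation ℚ W.j)
    {ℓ k : ℕ} [Fact ℓ.Prime] (hℓv : (ℓ : 𝓞 ℚ) ∉ v.asIdeal) (hk : 1 ≤ k)
    {P : geomPoints W} (hP : addOrderOf P = ℓ ^ k)
    {r : absoluteGaloisGroup ℚ →* (ZMod (ℓ ^ k))ˣ}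
    (hr : ∀ σ : absoluteGaloisGroup ℚ, σ • P = ((r σ : (ZMod (ℓ ^ k))ˣ) : ZMod (ℓ ^ k)).val • P)
    {𝔓 : Ideal (absIntegers (𝓞 ℚ) ℚ)} (h𝔓 : 𝔓 ∈ v.primesAbove)
    {τ : absoluteGaloisGroup ℚ} (hτ : τ ∈ 𝔓.inertia (absoluteGaloisGroup ℚ)) :
    Depth ℓ k (halfCeil k) (r τ ^ 2) := by
  sorry

/-! ## X — the place `ℓ`: per-`τ` image bounds `#((τ−1)·W[ℓᵐ]) ≤ ℓᵐ` (NEW: replaces gen-3 D2/D3/CycRes) -/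

/-- Xo (S, one cycle): good ORDINARY reduction at the odd prime `ℓ`, `W` globally minimal ⇒
`#((τ−1)·W[ℓᵐ]) ≤ ℓᵐ` for every `τ ∈ I_ℓ`.  This is the LANDED
`WeierstrassCurve.card_map_smul_sub_geomTorsion_le_pow` (Serre 1968 IV A.2.2) once the good ordinary
model `(C, M)` over `ℤ_ℓ` is produced from `[W.IsGloballyMinimal] + HasGoodReductionAtPrime ℓ +
ℓ ∤ a_ℓ`: `M :=` the integral model at `v` (`localMinimalIntegralModel`-pattern), `IsUnit M.Δ` from
good reduction, `IsUnit (M.hasseCoeff ℓ)` from `intCast_frobeniusTrace_eq_hasseCoeff` (pattern: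
`Summits/Langlands/…/SkinnerWilesDefectOneFiveIsogenyEllipticCurvesGoodOrdinaryModel.lean`). -/
theorem card_map_smul_sub_le_pow_of_ordinary (W : WeierstrassCurve ℚ) [W.IsElliptic]
    [W.IsGloballyMinimal] {ℓ : ℕ} [Fact ℓ.Prime] (hℓ2 : ℓ ≠ 2)
    (hgood : W.HasGoodReductionAtPrime ℓ) (hord : ¬ ((ℓ : ℤ) ∣ W.frobeniusTrace ℓ))
    {v : HeightOneSpectrum (𝓞 ℚ)} (hℓv : (ℓ : 𝓞 ℚ) ∈ v.asIdeal)
    {𝔓 : Ideal (absIntegers (𝓞 ℚ) ℚ)} (h𝔓 : 𝔓 ∈ v.primesAbove)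
    {τ : absoluteGaloisGroup ℚ} (hτ : τ ∈ 𝔓.inertia (absoluteGaloisGroup ℚ)) (m : ℕ) :
    Nat.card ((geomTorsion W ((ℓ ^ m : ℕ) : ℤ)).map
      (DistribSMul.toAddMonoidHom (geomPoints W) τ - AddMonoidHom.id (geomPoints W))) ≤ ℓ ^ m := by
  sorry

/-- Xm (M, one cycle — the `1 ↦ m` PORT): multiplicative reduction at a place `v ∣ ℓ`, `ℓ` odd ⇒
`#((τ−1)·W[ℓᵐ]) ≤ ℓᵐ` for every `τ ∈ I_v`.  Proof = the landed proof of
`exists_addSubgroup_card_le_of_hasMultiplicativeReductionAt` (`SemistableModPImageMultiplicativeProofs`,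
Tate-form route: `(τ−1)·P` lands in the kernel of reduction of the Tate form, whose `ℓᵐ`-torsion
subgroups have order `≤ ℓᵐ` by `TateForm.card_addSubgroup_le_pow … m`) with the exponent `1`
replaced by `m` — the landed text already calls the `ℓᵐ`-version of the kernel-of-reduction count. -/
theorem card_map_smul_sub_le_pow_of_hasMultiplicativeReductionAt (W : WeierstrassCurve ℚ)
    [W.IsElliptic] {ℓ : ℕ} [Fact ℓ.Prime] (hℓ2 : ℓ ≠ 2)
    {v : HeightOneSpectrum (𝓞 ℚ)} (hℓv : (ℓ : 𝓞 ℚ) ∈ v.asIdeal)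
    (hmult : W.HasMultiplicativeReductionAt v)
    {𝔓 : Ideal (absIntegers (𝓞 ℚ) ℚ)} (h𝔓 : 𝔓 ∈ v.primesAbove)
    {τ : absoluteGaloisGroup ℚ} (hτ : τ ∈ 𝔓.inertia (absoluteGaloisGroup ℚ)) (m : ℕ) :
    Nat.card ((geomTorsion W ((ℓ ^ m : ℕ) : ℤ)).map
      (DistribSMul.toAddMonoidHom (geomPoints W) τ - AddMonoidHom.id (geomPoints W))) ≤ ℓ ^ m := by
  sorry

/-- SS (S, one cycle): a `Γ_ℚ`-stable point of prime order `ℓ ≥ 3` excludes good SUPERSINGULAR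
reduction at `ℓ` (the inertia image would be cyclic of order `ℓ² − 1`,
`isCyclic_and_card_inertia_map_of_dvd_frobeniusTrace_all`, acting irreducibly on `W[ℓ]`).  Inline
pattern: the `exfalso` branch of `Mazur1978.modEq_zero_or_one_of_hasGoodReductionAtPrime`
(`OpenImageMazurGoodAtNProofs`).  Apply to `ℓ^{k−1}·P`. -/
theorem not_dvd_frobeniusTrace_of_stableLine (W : WeierstrassCurve ℚ) [W.IsElliptic]
    [W.IsGloballyMinimal] (ℓ : ℕ) [Fact ℓ.Prime] (hℓ3 : 3 ≤ ℓ)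
    (hgood : W.HasGoodReductionAtPrime ℓ) {P : geomPoints W} (hP : addOrderOf P = ℓ)
    (hst : ∀ σ : absoluteGaloisGroup ℚ, σ • P ∈ AddSubgroup.zmultiples P) :
    ¬ ((ℓ : ℤ) ∣ W.frobeniusTrace ℓ) := by
  sorry

/-! ## DET / CMP — the quotient character is `χ·r⁻¹` (NEW at level `ℓᵏ`; prime level is landed) -/

/-- CMP (S, one cycle): a point `P` of order `ℓᵏ` has a COMPLEMENT `S` in `W[ℓᵏ] ≅ (ℤ/ℓᵏ)²`
(`card_torsionPoints_eq_sq_holds` + the `ZMod (ℓᵏ)`-module structure `AddSubgroup.torsionBy.zmodModule`: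
a primitive vector of a free rank-2 module over the local ring `ℤ/ℓᵏ` extends to a basis), i.e. the
class of `S` has order `ℓᵏ` in `W[ℓᵏ]/ℤP`. -/
theorem exists_quotientGenerator (W : WeierstrassCurve ℚ) [W.IsElliptic] {ℓ k : ℕ} [Fact ℓ.Prime]
    {P : geomPoints W} (hP : addOrderOf P = ℓ ^ k) :
    ∃ S : geomPoints W, ℓ ^ k • S = 0 ∧
      ∀ c : ℤ, c • S ∈ AddSubgroup.zmultiples P → ((ℓ ^ k : ℕ) : ℤ) ∣ c := by
  sorry

/-- DET (S/M, one cycle): the shape `(r *; 0 χ r⁻¹)` of `ρ_{E,ℓᵏ}` along a stable line of order `ℓᵏ`: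
for every `σ` and every `S ∈ W[ℓᵏ]`, `σS − (χ_{ℓᵏ}(σ)·r(σ)⁻¹)·S ∈ ℤP`.  Port of the landed
prime-level `Mazur1978.smul_sub_smul_mem_zmultiples_of_isogenyCharacter` using the landed level-`m`
`det_eq_modNCyclotomicCharacter` (frame `e : W[ℓᵏ] ≃+ (Fin 2 → ZMod (ℓᵏ))` with `e P = (1,0)` from CMP). -/
theorem smul_sub_smul_mem_zmultiples_primePow (W : WeierstrassCurve ℚ) [W.IsElliptic]
    {ℓ k : ℕ} [Fact ℓ.Prime] (hk : 1 ≤ k) {P : geomPoints W} (hP : addOrderOf P = ℓ ^ k)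
    {r : absoluteGaloisGroup ℚ →* (ZMod (ℓ ^ k))ˣ}
    (hr : ∀ σ : absoluteGaloisGroup ℚ, σ • P = ((r σ : (ZMod (ℓ ^ k))ˣ) : ZMod (ℓ ^ k)).val • P)
    (σ : absoluteGaloisGroup ℚ) (S : geomPoints W) (hS : ℓ ^ k • S = 0) :
    σ • S - ((modNCyclotomicCharacter ℚ (ℓ ^ k) σ * (r σ)⁻¹ : (ZMod (ℓ ^ k))ˣ) :
      ZMod (ℓ ^ k)).val • S ∈ AddSubgroup.zmultiples P := by
  sorry

/-! ## ALG — the two-sided sandwich (NEW, pure algebra; brute-force checkable over `(ℤ/9)², (ℤ/25)², (ℤ/27)²`) -/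

/-- ALG1 (M, one cycle, pure algebra): `T` of order `ℓ^{2k}` (`= W[ℓᵏ]`), `P ∈ T` of order `ℓᵏ`,
`S` a complement (its class has order `ℓᵏ` in `T/ℤP`, so `T/ℤP = ⟨S̄⟩`), `f = τ − 1` an
endomorphism with `#f(T) ≤ ℓᵏ`, `f P = (λ−1)P`, `f S ≡ (λ'−1)S mod ℤP`.  Then with
`ℓʲ := #(f(T) ∩ ℤP)`: `(λ−1)P ∈ f(T) ∩ ℤP = ⟨ℓ^{k−j}P⟩ ⇒ ℓ^{k−j} ∣ λ − 1`, and `f̄ = (λ'−1)` on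
the cyclic group `T/ℤP` of order `ℓᵏ` has image of order `ℓ^{k − v(λ'−1)} ≤ #f(T)/ℓʲ ≤ ℓ^{k−j}
⇒ ℓʲ ∣ λ' − 1`.  (k3 X1a's unipotent `(ℤ/9)²` witness gives `j = 1`, `λ = 4`, `λ' = 7`: sharp.) -/
theorem exists_depth_pair_of_card_range_le {T : Type*} [AddCommGroup T] [Finite T] {ℓ k : ℕ}
    (hℓ : ℓ.Prime) (hT : Nat.card T = ℓ ^ (2 * k)) {P S : T} (hP : addOrderOf P = ℓ ^ k)
    (hS : ∀ c : ℤ, c • S ∈ AddSubgroup.zmultiples P → ((ℓ ^ k : ℕ) : ℤ) ∣ c)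
    (f : T →+ T) (hf : Nat.card f.range ≤ ℓ ^ k) {lam lam' : ℤ}
    (hlam : f P = (lam - 1) • P) (hlam' : f S - (lam' - 1) • S ∈ AddSubgroup.zmultiples P) :
    ∃ j ≤ k, (ℓ : ℤ) ^ (k - j) ∣ lam - 1 ∧ (ℓ : ℤ) ^ j ∣ lam' - 1 := by
  sorry

/-- ALG2 (PROVED, pure group theory): a per-element sandwich on a subgroup is uniform.
If every `τ ∈ I` admits `j_τ` with `r(τ) ≡ 1 (ℓ^{k−j_τ})`, `r'(τ) ≡ 1 (ℓ^{j_τ})`, then ONE `j`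
works for all `τ ∈ I`: with `a := min_I depth(r)`, `b := min_I depth(r')` attained at `τ₁, τ₂`,
either one of them already has `depth + depth' = a + b`, or `τ₁τ₂` does (strict ultrametric
minimum: `v(x₁x₂ − 1) = v(x₁ − 1)` when `v(x₁ − 1) < v(x₂ − 1)`); hence `a + b ≥ k`. -/
theorem depth_zero {ℓ k : ℕ} {u : (ZMod (ℓ ^ k))ˣ} : Depth ℓ k 0 u := by
  unfold Depth; rw [pow_zero]; exact one_dvd _

theorem depth_mono {ℓ k a b : ℕ} {u : (ZMod (ℓ ^ k))ˣ} (hab : a ≤ b) (h : Depth ℓ k b u) :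
    Depth ℓ k a u := by
  unfold Depth at h ⊢; exact (pow_dvd_pow _ hab).trans h

/-- Depth `a ≤ k` is "`= 1` in `ℤ/ℓᵃ`". -/
theorem depth_iff_cast {ℓ k a : ℕ} (hℓ : ℓ.Prime) (ha : a ≤ k) (u : (ZMod (ℓ ^ k))ˣ) :
    Depth ℓ k a u ↔ ZMod.castHom (pow_dvd_pow ℓ ha) (ZMod (ℓ ^ a)) (u : ZMod (ℓ ^ k)) = 1 := by
  haveI : NeZero (ℓ ^ k) := ⟨pow_ne_zero _ hℓ.ne_zero⟩
  unfold Depth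
  set n := (u : ZMod (ℓ ^ k)).val with hn
  have hu : (u : ZMod (ℓ ^ k)) = (n : ZMod (ℓ ^ k)) := (ZMod.natCast_zmod_val _).symm
  rw [hu, map_natCast, ← Nat.cast_one (R := ZMod (ℓ ^ a)), ZMod.natCast_eq_natCast_iff,
    Nat.modEq_iff_dvd]
  push_cast
  exact dvd_sub_comm

theorem depth_mul_iff_left {ℓ k a : ℕ} (hℓ : ℓ.Prime) (ha : a ≤ k) {u₁ u₂ : (ZMod (ℓ ^ k))ˣ}
    (h₂ : Depth ℓ k a u₂) : Depth ℓ k a (u₁ * u₂) ↔ Depth ℓ k a u₁ := by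
  rw [depth_iff_cast hℓ ha] at h₂ ⊢
  rw [depth_iff_cast hℓ ha, Units.val_mul, map_mul, h₂, mul_one]

theorem depth_mul_iff_right {ℓ k a : ℕ} (hℓ : ℓ.Prime) (ha : a ≤ k) {u₁ u₂ : (ZMod (ℓ ^ k))ˣ}
    (h₁ : Depth ℓ k a u₁) : Depth ℓ k a (u₁ * u₂) ↔ Depth ℓ k a u₂ := by
  rw [mul_comm]; exact depth_mul_iff_left hℓ ha h₁

theorem exists_uniform_depth_pair {G : Type*} [Group G] (I : Subgroup G) {ℓ k : ℕ} (hℓ : ℓ.Prime)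
    (r r' : G →* (ZMod (ℓ ^ k))ˣ)
    (h : ∀ τ ∈ I, ∃ j ≤ k, Depth ℓ k (k - j) (r τ) ∧ Depth ℓ k j (r' τ)) :
    ∃ j ≤ k, ∀ τ ∈ I, Depth ℓ k (k - j) (r τ) ∧ Depth ℓ k j (r' τ) := by
  classical
  let Pa : ℕ → Prop := fun a => ∀ τ ∈ I, Depth ℓ k a (r τ)
  let Pb : ℕ → Prop := fun b => ∀ τ ∈ I, Depth ℓ k b (r' τ)
  have hPa0 : Pa 0 := fun τ _ => depth_zero
  have hPb0 : Pb 0 := fun τ _ => depth_zero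
  have ha₀k : Nat.findGreatest Pa k ≤ k := Nat.findGreatest_le k
  have hb₀k : Nat.findGreatest Pb k ≤ k := Nat.findGreatest_le k
  have hPa : Pa (Nat.findGreatest Pa k) := Nat.findGreatest_spec (Nat.zero_le k) hPa0
  have hPb : Pb (Nat.findGreatest Pb k) := Nat.findGreatest_spec (Nat.zero_le k) hPb0
  have hmaxa : ∀ a, Nat.findGreatest Pa k < a → a ≤ k → ¬ Pa a :=
    fun a h1 h2 => Nat.findGreatest_is_greatest h1 h2
  have hmaxb : ∀ b, Nat.findGreatest Pb k < b → b ≤ k → ¬ Pb b :=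
    fun b h1 h2 => Nat.findGreatest_is_greatest h1 h2
  set a₀ := Nat.findGreatest Pa k with ha₀
  set b₀ := Nat.findGreatest Pb k with hb₀
  by_cases hsum : k ≤ a₀ + b₀
  · refine ⟨k - a₀, Nat.sub_le k a₀, fun τ hτ => ⟨?_, ?_⟩⟩
    · rw [Nat.sub_sub_self ha₀k]; exact hPa τ hτ
    · exact depth_mono (by omega) (hPb τ hτ)
  · exfalso
    have ha1 := hmaxa (a₀ + 1) (Nat.lt_succ_self a₀) (by omega)
    have hb1 := hmaxb (b₀ + 1) (Nat.lt_succ_self b₀) (by omega)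
    simp only [Pa, Pb, not_forall] at ha1 hb1
    obtain ⟨τ₁, hτ₁, hn₁⟩ := ha1
    obtain ⟨τ₂, hτ₂, hn₂⟩ := hb1
    have hd₁ : Depth ℓ k (b₀ + 1) (r' τ₁) := by
      obtain ⟨j, hj, hjr, hjr'⟩ := h τ₁ hτ₁
      have : ¬ (a₀ + 1 ≤ k - j) := fun hle => hn₁ (depth_mono hle hjr)
      exact depth_mono (by omega) hjr'
    have hd₂ : Depth ℓ k (a₀ + 1) (r τ₂) := by
      obtain ⟨j, hj, hjr, hjr'⟩ := h τ₂ hτ₂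
      have : ¬ (b₀ + 1 ≤ j) := fun hle => hn₂ (depth_mono hle hjr')
      exact depth_mono (by omega) hjr
    obtain ⟨j, hj, hjr, hjr'⟩ := h (τ₁ * τ₂) (I.mul_mem hτ₁ hτ₂)
    rw [map_mul] at hjr hjr'
    have h1 : ¬ (a₀ + 1 ≤ k - j) := fun hle =>
      hn₁ ((depth_mul_iff_left hℓ (by omega) hd₂).mp (depth_mono hle hjr))
    have h2 : ¬ (b₀ + 1 ≤ j) := fun hle =>
      hn₂ ((depth_mul_iff_right hℓ (by omega) hd₁).mp (depth_mono hle hjr'))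
    omega

/-- LOCℓ (S/M assembly at `ℓ`, one cycle): `W` globally minimal, semistable at the odd prime `ℓ`,
`P` a stable point of order `ℓᵏ` (`k ≥ 1`) with character `r` ⇒ ONE `j ≤ k` with
`r ≡ 1 (ℓ^{k−j})` and `χ·r⁻¹ ≡ 1 (ℓʲ)` on all of `I_ℓ`.  Cases of `W.IsSemistableAt v`: good ⇒
ordinary by SS (applied to `ℓ^{k−1}P`) ⇒ Xo; multiplicative ⇒ Xm; then per `τ`: CMP gives `S`,
DET gives `f S ≡ (λ'−1)S mod ℤP` with `λ' = (χ(τ)r(τ)⁻¹).val`, `#T = ℓ^{2k}`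
(`card_torsionPoints_eq_sq_holds`), ALG1; uniformise with ALG2 (conjugate primes `𝔓 ∣ v` give
conjugate inertia groups; depths are conjugation invariant, or run ALG2 on each `I_𝔓` and take the
`j` of any one — all `I_𝔓` have the same image). -/
theorem exists_depth_pair_at_ell (W : WeierstrassCurve ℚ) [W.IsElliptic] [W.IsGloballyMinimal]
    (ℓ k : ℕ) [Fact ℓ.Prime] (hℓ2 : ℓ ≠ 2) (hk : 1 ≤ k)
    {v : HeightOneSpectrum (𝓞 ℚ)} (hℓv : (ℓ : 𝓞 ℚ) ∈ v.asIdeal) (hss : W.IsSemistableAt v)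
    {P : geomPoints W} (hP : addOrderOf P = ℓ ^ k)
    {r : absoluteGaloisGroup ℚ →* (ZMod (ℓ ^ k))ˣ}
    (hr : ∀ σ : absoluteGaloisGroup ℚ, σ • P = ((r σ : (ZMod (ℓ ^ k))ˣ) : ZMod (ℓ ^ k)).val • P) :
    ∃ j ≤ k, ∀ 𝔓 ∈ v.primesAbove, ∀ τ ∈ 𝔓.inertia (absoluteGaloisGroup ℚ),
      Depth ℓ k (k - j) (r τ) ∧ Depth ℓ k j (modNCyclotomicCharacter ℚ (ℓ ^ k) τ * (r τ)⁻¹) := by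
  sorry

/-! ## MK — Minkowski at a given depth (S) -/

/-- MK (S, one cycle): a character of `Γ_ℚ` into `(ℤ/ℓᵏ)ˣ` with open kernel which has depth `a` on
every inertia group has depth `a` everywhere: compose with `ZMod.unitsMap (ℓᵃ ∣ ℓᵏ)` (for `a ≤ k`;
for `a > k` depth `a` means `= 1`) and apply `Mazur1978.monoidHom_eq_one_of_forall_inertia`
(ℚ has no unramified extensions).  Used for `ψ = r¹²` (kernel ⊇ stabiliser of `P`,
`isOpen_stabilizer_point_holds`) and `ψ = (χ·r⁻¹)¹²` (kernel ⊇ stab(P) ∩ ker χ). -/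
theorem depth_of_forall_inertia {ℓ k : ℕ} [Fact ℓ.Prime] (a : ℕ)
    (ψ : absoluteGaloisGroup ℚ →* (ZMod (ℓ ^ k))ˣ)
    (hker : IsOpen ((ψ.ker : Subgroup (absoluteGaloisGroup ℚ)) : Set (absoluteGaloisGroup ℚ)))
    (h : ∀ (v : HeightOneSpectrum (𝓞 ℚ)), ∀ 𝔓 ∈ v.primesAbove,
      ∀ τ ∈ 𝔓.inertia (absoluteGaloisGroup ℚ), Depth ℓ k a (ψ τ)) :
    ∀ σ : absoluteGaloisGroup ℚ, Depth ℓ k a (ψ σ) := by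
  sorry

/-! ## A1 / H5 — Frobenius end and the line's typed output (statements = gen 3, proof route new) -/

/-- `n₁₂(p) = p¹² + 1 − s₁₂(a_p, p) = #E(𝔽_{p¹²})` (as an integer). -/
noncomputable def frobNorm (W : WeierstrassCurve ℚ) [W.IsGloballyMinimal] (p : ℕ) : ℤ :=
  (p : ℤ) ^ 12 + 1 - Mazur1978.frobTracePow (W.frobeniusTrace p) p 12

/-- A1 (PROVED; gen-2 k2's resultant lemma in the two-branch form this cut needs): a root `t`
of `X² − aX + p` in `ℤ/n` (`p` a unit) with `t¹² = 1` OR `t¹² = p¹²` forces `n ∣ p¹² + 1 − s₁₂(a,p)`.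
Proof: `t` is a unit (`t(a − t) = p`), `Mazur1978.frobTracePow_spec` with `α = t`, `β = a − t = p·t⁻¹`
gives `s₁₂ = t¹² + p¹²·t⁻¹²`, which is `1 + p¹²` in both branches; `ZMod.intCast_zmod_eq_zero_iff_dvd`. -/
theorem natCast_dvd_frobNorm_of_pow_twelve {n p : ℕ} [NeZero n] (a : ℤ) (hp : IsUnit (p : ZMod n))
    {t : ZMod n} (hroot : t ^ 2 - (a : ZMod n) * t + (p : ZMod n) = 0)
    (ht : t ^ 12 = 1 ∨ t ^ 12 = (p : ZMod n) ^ 12) :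
    (n : ℤ) ∣ (p : ℤ) ^ 12 + 1 - Mazur1978.frobTracePow a p 12 := by
  have hprod' : t * ((a : ZMod n) - t) = (p : ZMod n) := by
    linear_combination (-1 : ZMod n) * hroot
  have hsum : t + ((a : ZMod n) - t) = ((a : ℤ) : ZMod n) := by ring
  have hprod : t * ((a : ZMod n) - t) = (((p : ℕ) : ℤ) : ZMod n) := by
    rw [hprod', Int.cast_natCast]
  have hspec := Mazur1978.frobTracePow_spec hsum hprod 12
  have h12 : ((a : ZMod n) - t) ^ 12 * t ^ 12 = (p : ZMod n) ^ 12 := by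
    rw [← mul_pow, mul_comm, hprod']
  rw [← ZMod.intCast_zmod_eq_zero_iff_dvd]
  push_cast
  rw [← hspec]
  rcases ht with h1 | h2
  · rw [h1, mul_one] at h12
    rw [h1, h12]; ring
  · rw [h2] at h12
    have h3 : ((a : ZMod n) - t) ^ 12 = 1 :=
      (hp.pow 12).mul_right_cancel (h12.trans (one_mul _).symm)
    rw [h2, h3]; ring

/-- H5 (S assembly; SAME statement as gen 3 — new proof): G0-shape input (`P` stable of order `ℓᵏ`,
`r` from `exists_cyclicCharacter_of_addOrderOf`); LOCℓ gives `(k−j, j)` at `ℓ`; put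
`a'' := min (k−j) ⌈k/2⌉`, `b'' := min j ⌈k/2⌉`, so `max a'' b'' = ⌈k/2⌉` (`halfCeil_le_max`).
Depth `a''` of `r¹²` on every inertia: `I_ℓ` (LOCℓ), good `v ∤ 2ℓ`
(`Mazur1978.cyclicCharacter_eq_one_of_mem_inertia`), multiplicative `v ∤ 2ℓ` (U2, from `hss`), `v = 2`
(T1 if `v.valuation ℚ W₁.j ≤ 1`, else T2); depth `b''` of `(χr⁻¹)¹²` likewise (`χ` unramified at
`v ∤ ℓ`: `modNCyclotomicCharacter_eq_one_of_mem_inertia`; depth is inversion invariant).  MK twice.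
At an arithmetic Frobenius `φ` over `p`: `λ := r φ` is a root of `X² − a_pX + p`
(`Mazur1978.cyclicCharacter_sq_sub_frobeniusTrace_mul_add_eq_zero`, level `ℓᵏ`, good prime `p ≠ ℓ`),
`χ(φ) = p` (`modNCyclotomicCharacter_eq_residueCard_of_isArithFrobAt`); cast to `ZMod (ℓ^{a''})`
resp. `ZMod (ℓ^{b''})`: `λ¹² = 1` resp. `λ¹² = p¹²`; A1 in each modulus; the larger is `ℓ^⌈k/2⌉`. -/
theorem pow_halfCeil_dvd_frobNorm_of_stableLine (W₁ : WeierstrassCurve ℚ) [W₁.IsElliptic]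
    [W₁.IsGloballyMinimal] (ℓ k : ℕ) [Fact ℓ.Prime] (hℓ2 : ℓ ≠ 2)
    (hss : ∀ v : HeightOneSpectrum (𝓞 ℚ), (2 : 𝓞 ℚ) ∉ v.asIdeal → W₁.IsSemistableAt v)
    {P : geomPoints W₁} (hP : addOrderOf P = ℓ ^ k)
    (hst : ∀ σ : absoluteGaloisGroup ℚ, σ • P ∈ AddSubgroup.zmultiples P)
    (p : ℕ) [Fact p.Prime] (hp2 : p ≠ 2) (hpℓ : p ≠ ℓ) (hgood : W₁.HasGoodReductionAtPrime p) :
    (ℓ : ℤ) ^ halfCeil k ∣ frobNorm W₁ p := by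
  sorry

/-- H5′ (S, OPTIONAL sharper output when `W₁` is semistable EVERYWHERE — e.g. `freyCurve a b` or its
`−1`-twist when `16 ∣ abc`, `isSemistable_freyCurve_of_sixteen_dvd`): no 12th power is needed
(`e = 1`), and the two branches `λ ≡ 1 (ℓ^{a''})`, `λ ≡ p (ℓ^{b''})` give
`ℓ^⌈k/2⌉ ∣ p + 1 − a_p = #W̃₁(𝔽_p)` — a Katz-1981-type divisibility, numerically sharp
(`11a3`: cyclic `25`-isogeny, `5 ∥ #Ẽ(𝔽_p)` for `p = 2, 3`). -/
theorem pow_halfCeil_dvd_card_reduction_of_semistable (W₁ : WeierstrassCurve ℚ) [W₁.IsElliptic]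
    [W₁.IsGloballyMinimal] (ℓ k : ℕ) [Fact ℓ.Prime] (hℓ2 : ℓ ≠ 2)
    (hss : ∀ v : HeightOneSpectrum (𝓞 ℚ), W₁.IsSemistableAt v)
    {P : geomPoints W₁} (hP : addOrderOf P = ℓ ^ k)
    (hst : ∀ σ : absoluteGaloisGroup ℚ, σ • P ∈ AddSubgroup.zmultiples P)
    (p : ℕ) [Fact p.Prime] (hpℓ : p ≠ ℓ) (hgood : W₁.HasGoodReductionAtPrime p) :
    (ℓ : ℤ) ^ halfCeil k ∣ (p : ℤ) + 1 - W₁.frobeniusTrace p := by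
  sorry

/-! ## G0 / C1 / C0 / diameter — the counting end (gen 3, verbatim) -/

/-- G0 (XS glue): the `ℓ`-primary part of the (cyclic, `Γ_ℚ`-stable) kernel of a cyclic isogeny is a
stable cyclic line of order `ℓ^{v_ℓ(deg)}` (characteristic subgroup of a stable subgroup). -/
theorem exists_stableLine_of_isCyclic {W₁ W₂ : WeierstrassCurve ℚ} [W₁.IsElliptic] [W₂.IsElliptic]
    (φ : Isogeny W₁ W₂) (hφ : φ.IsCyclic) (ℓ k : ℕ) [Fact ℓ.Prime] (hdiv : ℓ ^ k ∣ φ.degree) :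
    ∃ P : geomPoints W₁, addOrderOf P = ℓ ^ k ∧
      ∀ σ : absoluteGaloisGroup ℚ, σ • P ∈ AddSubgroup.zmultiples P := by
  sorry

/-- C1 (counting end, PROVED): half exponents at every prime give `d ∣ n²`. -/
theorem dvd_sq_of_forall_pow_halfCeil_dvd {d n : ℕ} (hd : 0 < d) (hn : 0 < n)
    (h : ∀ ℓ : ℕ, ℓ.Prime → ℓ ∣ d → ℓ ^ halfCeil (d.factorization ℓ) ∣ n) : d ∣ n ^ 2 := by
  rw [← Nat.factorization_le_iff_dvd hd.ne' (pow_pos hn 2).ne', Nat.factorization_pow]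
  refine Finsupp.le_def.mpr fun ℓ => ?_
  rw [Finsupp.smul_apply, smul_eq_mul]
  by_cases hℓ : ℓ.Prime
  · by_cases hℓd : ℓ ∣ d
    · have h2 : halfCeil (d.factorization ℓ) ≤ n.factorization ℓ :=
        (hℓ.pow_dvd_iff_le_factorization hn.ne').mp (h ℓ hℓ hℓd)
      have h3 := le_two_mul_halfCeil (d.factorization ℓ)
      omega
    · rw [Nat.factorization_eq_zero_of_not_dvd hℓd]; exact Nat.zero_le _
  · rw [Nat.factorization_eq_zero_of_not_prime d hℓ]; exact Nat.zero_le _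

/-- C0 (the typed output of the line, Mazur–Kenku-free; SAME as gen 3): for `W₁` globally minimal and
semistable away from `2`, a cyclic isogeny out of `W₁` has degree dividing `16·(n₁₂(p₀)·n₁₂(p₁))²`
for any two distinct odd good primes.  From G0 + H5 (at the `pᵢ ≠ ℓ`) + C1 for the odd part, and the
landed `Summit.ABC.ABC.Theorems.isogeny_isCyclic_degree_ne_thirtyTwo`
(+ `Isogeny.exists_isCyclic_degree_eq_of_dvd`) for the `2`-part. -/
def CyclicDegreeDvdFrobNormSq : Prop :=
  ∀ (W₁ W₂ : WeierstrassCurve ℚ) [W₁.IsElliptic] [W₂.IsElliptic] [W₁.IsGloballyMinimal],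
    (∀ v : HeightOneSpectrum (𝓞 ℚ), (2 : 𝓞 ℚ) ∉ v.asIdeal → W₁.IsSemistableAt v) →
    ∀ (φ : Isogeny W₁ W₂), φ.IsCyclic →
    ∀ (p₀ p₁ : ℕ) [Fact p₀.Prime] [Fact p₁.Prime], p₀ ≠ 2 → p₁ ≠ 2 → p₀ ≠ p₁ →
      W₁.HasGoodReductionAtPrime p₀ → W₁.HasGoodReductionAtPrime p₁ →
      φ.degree ∣ 16 * ((frobNorm W₁ p₀ * frobNorm W₁ p₁).natAbs) ^ 2

theorem cyclicDegreeDvdFrobNormSq : CyclicDegreeDvdFrobNormSq := by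
  sorry

/-- k1's replacement input, verbatim (`…Sketch.Ideas1.FreyIsogenyDiameter`). -/
def FreyIsogenyDiameter : Prop :=
  ∀ ε : ℝ, 0 < ε → ∃ C : ℝ, ∀ a b : ℤ, IsCoprime a b → a * b * (a + b) ≠ 0 →
    ∀ (W₁ W₂ : WeierstrassCurve ℚ) [W₁.IsElliptic] [W₂.IsElliptic],
      (freyCurve a b).IsIsogenous W₁ → (freyCurve a b).IsIsogenous W₂ →
      ∀ φ : Isogeny W₁ W₂, φ.IsCyclic →
        (φ.degree : ℝ) ≤ C * (((freyCurve a b).conductorNorm ℤ : ℕ) : ℝ) ^ ε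

/-- ASSEMBLY (S, as gen 3): C0 at a globally minimal model of `W₁` (degree is model-independent),
which is semistable away from `2` (the Frey curve is; isogeny invariance), k1 H7 (`0 < n₁₂(p) ≤ (p⁶+1)²`,
Hasse) and k1 H8 (two odd good primes `≪_δ N^δ`, Bertrand), `δ = ε/48`; then k1's
`definiteRTControlPrime_of_diameter stub_takahashi hDiam` closes the crux with `C(ε) = 4·C_diam(ε/2)²`
in place of `4·163²`. -/
theorem freyIsogenyDiameter_of_halfLevel (h0 : CyclicDegreeDvdFrobNormSq) : FreyIsogenyDiameter := by
  sorry

/-! ## Sanity (k3 X1a's `(ℤ/9)²` unipotent witness: `λ = 4`, `λ' = 7`, `j = 1` — ALG1 is sharp and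
the half level `⌈2/2⌉ = 1` is what survives). -/
example : (3 : ℤ) ^ (2 - 1) ∣ 4 - 1 ∧ (3 : ℤ) ^ 1 ∣ 7 - 1 ∧ ¬ ((3 : ℤ) ^ 2 ∣ 4 - 1) ∧
    ¬ ((3 : ℤ) ^ 2 ∣ 7 - 1) ∧ halfCeil 2 = 1 := by decide

end Summit.ABC.ABC.Cruxes.DefiniteRTControlPrime.Sketch.Ideas2g4
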